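import Summits.Ventures.YMGap.Thresholds.OneLinkRemainderGradientL2
import Summits.Ventures.YMGap.Thresholds.OneLinkSDQuadScale
import HarnessLib

/-!
# Venture YMGap — the one-link modulus beyond first order, part 35: the `L²(ν_B)` gradient norm of the cubic remainder with
# the QUADRATIC WORDS kept in `L²`

HONEST FRAMING: venture file of the cell `pub-ymgap` (QuantumFields programme), strong-coupling LATTICE bookkeeping for `SU(N)`
lattice Yang–Mills; nothing about the continuum or the mass gap in the Clay sense.  No number of record moves here.

WHAT.  Same pointwise majorant `P` of `Γ(c₃,c₃) ≤ P²` (`OneLinkRemainderGradient.Gam_c3_le`) as the crude column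
(`OneLinkRemainderGradientL2.c3bound_le_affine`), but the quadratic words `|w| = |tr(gΔgB)|`, `|w_BB| = |tr(gBgB)|` are NOT replaced by
their sup norms `‖Δ‖_F‖B‖_F`, `‖B‖_F²`: they stay as two further random pieces of an affine majorant
  `P ≤ a_Q + b₁|tr(gB)| + b₂|tr(gΔ)| + b₃|w| + b₄|w_BB|`,
`a_Q = 4κ_w r²‖Δ‖_F + ‖B‖_F²‖Δ‖_F(½κ₁ + ½(κ_t − c))`, `b₃ = ‖B‖_F(2κ_w/N + ½κ₁)`, `b₄ = ½κ₁‖Δ‖_F` (`b₁, b₂` as before), and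
Minkowski in `L²(ν_B)` with four pieces gives
* `sqrt_integral_Gam_c3_le_quad`: `√∫Γ(c₃,c₃) dν_B ≤ a_Q + b₁Z₁ + b₂Z₂ + b₃W_{ΔB} + b₄W_{BB}`,
  `W_{M₁M₂} = √E|tr(gM₁gM₂)|²` — to be fed with `OneLinkSDQuadScale` (`‖B‖_F W_{ΔB} ≤ ‖Δ‖_F Nτ`, `W_{BB} ≤ Nτ`).

References: cell note `HOME/p2/ONE-LINK-HIERARCHY.md` §4 (4.6), §13 option (2).
-/

noncomputable section

open scoped Matrix ComplexConjugate BigOperators ContDiff Matrix.Norms.Frobenius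
open Matrix Complex Finset MeasureTheory ProbabilityTheory
open Literature.MathematicalPhysics.QuantumFieldTheory
open Literature.MathematicalPhysics.QuantumFieldTheory.SUNBakryEmery

namespace Summit.Ventures.YMGap.OneLinkEigen

variable {N : ℕ}

/-- Minkowski in `L²` with four random pieces behind a constant: if `F ≤ (a + b + c + d + e)²` pointwise with `a ≥ 0` constant and
`b, c, d, e` continuous, then `√∫F ≤ a + ‖b‖₂ + ‖c‖₂ + ‖d‖₂ + ‖e‖₂`. [folklore] -/
theorem sqrt_integral_le_of_le_add_sq_four {F b c d e : SUN N → ℝ} {a : ℝ} (hF : Continuous F) (hb : Continuous b)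
    (hc : Continuous c) (hd : Continuous d) (he : Continuous e) (ha : 0 ≤ a) (hle : ∀ x, F x ≤ (a + b x + c x + d x + e x) ^ 2)
    (μ : Measure (SUN N)) [IsProbabilityMeasure μ] :
    Real.sqrt (∫ x, F x ∂μ) ≤ a + Real.sqrt (∫ x, b x ^ 2 ∂μ) + Real.sqrt (∫ x, c x ^ 2 ∂μ)
      + Real.sqrt (∫ x, d x ^ 2 ∂μ) + Real.sqrt (∫ x, e x ^ 2 ∂μ) := by
  have h1 := sqrt_integral_le_of_le_add_sq (b := fun x => b x + c x) (c := fun x => d x + e x) hF (hb.add hc) (hd.add he) ha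
    (fun x => by have := hle x; simpa [add_assoc] using this) μ
  have h2 := sqrt_integral_add_sq_le hb hc μ
  have h3 := sqrt_integral_add_sq_le hd he μ
  linarith only [h1, h2, h3]

/-- **The pointwise majorant of `P`, affine in `‖tr(gB)‖, ‖tr(gΔ)‖, ‖tr(gΔgB)‖, ‖tr(gBgB)‖`** (only `|Im tr(gB)| ≤ ‖tr(gB)‖`,
`|Im tr(gB)| ≤ N‖B‖_op`, `‖tr(gB)‖ ≤ √N‖B‖_F` are used; the quadratic words are kept). [folklore] -/
theorem c3bound_le_affineQ (hN : 3 ≤ N) (B Δ : Matrix (Fin N) (Fin N) ℂ) (g : SUN N) :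
    (4 * ((N : ℝ) ^ 2 / (4 * ((N : ℝ) ^ 2 - 4))) * matrixOpNorm B ^ 2 * frobNorm Δ
        + 2 * ((N : ℝ) ^ 2 / (4 * ((N : ℝ) ^ 2 - 4))) / N *
          (2 * matrixOpNorm B * frobNorm Δ * |((g : Matrix (Fin N) (Fin N) ℂ) * B).trace.im|
            + frobNorm B * ‖((g : Matrix (Fin N) (Fin N) ℂ) * Δ * g * B).trace‖)
        + 1 / 2 * (((N : ℝ) / (2 * ((N : ℝ) ^ 2 - 4))) + 1 / (4 * (N : ℝ))) *
          (2 * matrixOpNorm B * frobNorm B * ‖((g : Matrix (Fin N) (Fin N) ℂ) * Δ).trace‖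
            + frobNorm Δ * ‖((g : Matrix (Fin N) (Fin N) ℂ) * B * g * B).trace‖)
        + 1 / 2 * (((N : ℝ) / (2 * ((N : ℝ) ^ 2 - 4))) + 1 / (4 * (N : ℝ))) *
          (2 * matrixOpNorm B * frobNorm Δ * ‖((g : Matrix (Fin N) (Fin N) ℂ) * B).trace‖
            + frobNorm B * ‖((g : Matrix (Fin N) (Fin N) ℂ) * Δ * g * B).trace‖)
        + 1 / 2 * (((N : ℝ) / (2 * ((N : ℝ) ^ 2 - 4))) - 1 / (4 * (N : ℝ))) * frobNorm B ^ 2 * frobNorm Δ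
        + 1 / 2 * (((N : ℝ) / (2 * ((N : ℝ) ^ 2 - 4))) + 1 / (4 * (N : ℝ))) * frobNorm B ^ 2 * frobNorm Δ
        + 2 * ((N : ℝ) / (2 * ((N : ℝ) ^ 2 - 4))) / N *
          (frobNorm B * |((g : Matrix (Fin N) (Fin N) ℂ) * B).trace.im| * ‖((g : Matrix (Fin N) (Fin N) ℂ) * Δ).trace‖
            + frobNorm Δ * |((g : Matrix (Fin N) (Fin N) ℂ) * B).trace.im| * ‖((g : Matrix (Fin N) (Fin N) ℂ) * B).trace‖
            + frobNorm B * ‖((g : Matrix (Fin N) (Fin N) ℂ) * B).trace‖ * ‖((g : Matrix (Fin N) (Fin N) ℂ) * Δ).trace‖)) ≤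
      (4 * ((N : ℝ) ^ 2 / (4 * ((N : ℝ) ^ 2 - 4))) * matrixOpNorm B ^ 2 * frobNorm Δ + frobNorm B ^ 2 * frobNorm Δ * (1 / 2 * (((N : ℝ) / (2 * ((N : ℝ) ^ 2 - 4))) + 1 / (4 * (N : ℝ))) + 1 / 2 * (((N : ℝ) / (2 * ((N : ℝ) ^ 2 - 4))) - 1 / (4 * (N : ℝ)))))
        + (frobNorm Δ * matrixOpNorm B * (4 * ((N : ℝ) ^ 2 / (4 * ((N : ℝ) ^ 2 - 4))) / N + (((N : ℝ) / (2 * ((N : ℝ) ^ 2 - 4))) + 1 / (4 * (N : ℝ))) + 2 * ((N : ℝ) / (2 * ((N : ℝ) ^ 2 - 4))))) * ‖((g : Matrix (Fin N) (Fin N) ℂ) * B).trace‖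
        + (frobNorm B * ((((N : ℝ) / (2 * ((N : ℝ) ^ 2 - 4))) + 1 / (4 * (N : ℝ))) * matrixOpNorm B + 2 * ((N : ℝ) / (2 * ((N : ℝ) ^ 2 - 4))) * matrixOpNorm B + 2 * ((N : ℝ) / (2 * ((N : ℝ) ^ 2 - 4))) / N * Real.sqrt N * frobNorm B)) * ‖((g : Matrix (Fin N) (Fin N) ℂ) * Δ).trace‖
        + (frobNorm B * (2 * ((N : ℝ) ^ 2 / (4 * ((N : ℝ) ^ 2 - 4))) / N + 1 / 2 * (((N : ℝ) / (2 * ((N : ℝ) ^ 2 - 4))) + 1 / (4 * (N : ℝ))))) * ‖((g : Matrix (Fin N) (Fin N) ℂ) * Δ * g * B).trace‖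
        + (frobNorm Δ * (1 / 2 * (((N : ℝ) / (2 * ((N : ℝ) ^ 2 - 4))) + 1 / (4 * (N : ℝ))))) * ‖((g : Matrix (Fin N) (Fin N) ℂ) * B * g * B).trace‖ := by
  have hN0 : N ≠ 0 := by omega
  have h3 : (3 : ℝ) ≤ N := by exact_mod_cast hN
  have hN4 : (0 : ℝ) < (N : ℝ) ^ 2 - 4 := by nlinarith
  have hNpos : (0 : ℝ) < N := by linarith
  have hsN : 0 < Real.sqrt N := Real.sqrt_pos.2 hNpos
  set κw : ℝ := (N : ℝ) ^ 2 / (4 * ((N : ℝ) ^ 2 - 4)) with hκw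
  set κt : ℝ := (N : ℝ) / (2 * ((N : ℝ) ^ 2 - 4)) with hκt
  have hκw0 : 0 ≤ κw := by positivity
  have hκt0 : 0 ≤ κt := by positivity
  set Q : Matrix (Fin N) (Fin N) ℂ := (g : Matrix (Fin N) (Fin N) ℂ) with hQ
  set r := matrixOpNorm B with hr
  set nB := frobNorm B with hnB
  set nD := frobNorm Δ with hnD
  set z1 := ‖(Q * B).trace‖ with hz1
  set z2 := ‖(Q * Δ).trace‖ with hz2
  set X := |(Q * B).trace.im| with hX
  set w := ‖(Q * Δ * Q * B).trace‖ with hw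
  set wBB := ‖(Q * B * Q * B).trace‖ with hwBB
  have hr0 : 0 ≤ r := matrixOpNorm_nonneg B
  have hnB0 : 0 ≤ nB := frobNorm_nonneg B
  have hnD0 : 0 ≤ nD := frobNorm_nonneg Δ
  have hz10 : 0 ≤ z1 := norm_nonneg _
  have hz20 : 0 ≤ z2 := norm_nonneg _
  have hX0 : 0 ≤ X := abs_nonneg _
  have hw0 : 0 ≤ w := norm_nonneg _
  have hwBB0 : 0 ≤ wBB := norm_nonneg _
  have bX1 : X ≤ z1 := abs_im_le_norm' _
  have bX2 : X ≤ N * r := by rw [hX, hQ]; exact abs_im_trace_su_mul_le_opNorm B g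
  have bz1 : z1 ≤ Real.sqrt N * nB := by rw [hz1, hQ]; exact norm_trace_su_mul_le B g
  have p1 : 2 * r * nD * X ≤ 2 * r * nD * z1 := mul_le_mul_of_nonneg_left bX1 (by positivity)
  have p4 : nB * X * z2 ≤ nB * (N * r) * z2 :=
    mul_le_mul_of_nonneg_right (mul_le_mul_of_nonneg_left bX2 hnB0) hz20
  have p5 : nD * X * z1 ≤ nD * (N * r) * z1 :=
    mul_le_mul_of_nonneg_right (mul_le_mul_of_nonneg_left bX2 hnD0) hz10
  have p6 : nB * z1 * z2 ≤ nB * (Real.sqrt N * nB) * z2 :=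
    mul_le_mul_of_nonneg_right (mul_le_mul_of_nonneg_left bz1 hnB0) hz20
  have hκ1 : 0 ≤ κt + 1 / (4 * (N : ℝ)) := by positivity
  have q1 := mul_le_mul_of_nonneg_left p1 (by positivity : (0 : ℝ) ≤ 2 * κw / N)
  have q4 := mul_le_mul_of_nonneg_left p4 (by positivity : (0 : ℝ) ≤ 2 * κt / N)
  have q5 := mul_le_mul_of_nonneg_left p5 (by positivity : (0 : ℝ) ≤ 2 * κt / N)
  have q6 := mul_le_mul_of_nonneg_left p6 (by positivity : (0 : ℝ) ≤ 2 * κt / N)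
  have hNne : (N : ℝ) ≠ 0 := hNpos.ne'
  have e4 : 2 * κt / N * (nB * (N * r) * z2) = 2 * κt * nB * r * z2 := by
    rw [div_mul_eq_mul_div, div_eq_iff hNne]; ring
  have e5 : 2 * κt / N * (nD * (N * r) * z1) = 2 * κt * nD * r * z1 := by
    rw [div_mul_eq_mul_div, div_eq_iff hNne]; ring
  rw [e4] at q4
  rw [e5] at q5
  simp only [div_eq_mul_inv] at q1 q4 q5 q6 ⊢
  nlinarith [q1, q4, q5, q6, mul_nonneg hκw0 hw0, mul_nonneg hκ1 hw0, mul_nonneg hκ1 hwBB0, mul_nonneg hnB0 hw0,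
    mul_nonneg hnD0 hwBB0]

/-- **The `L²(ν_B)` gradient norm of the cubic remainder with the quadratic words in `L²`**:
`√(∫ Γ(c₃,c₃) dν_B) ≤ a_Q + b₁ Z₁ + b₂ Z₂ + b₃ W_{ΔB} + b₄ W_{BB}`. [folklore] -/
theorem sqrt_integral_Gam_c3_le_quad (hN : 3 ≤ N) (B Δ : Matrix (Fin N) (Fin N) ℂ) :
    Real.sqrt (∫ g, Gam (Gam (pot 1 B) fun Q : Matrix (Fin N) (Fin N) ℂ =>
          -((N : ℝ) ^ 2 / (4 * ((N : ℝ) ^ 2 - 4))) * (Q * Δ * Q * B).trace.re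
            + ((N : ℝ) / (2 * ((N : ℝ) ^ 2 - 4))) * ((Q * B).trace * (Q * Δ).trace).re
            - (1 / (4 * (N : ℝ))) * ((Q * B).trace * (starRingEnd ℂ) (Q * Δ).trace).re)
        (Gam (pot 1 B) fun Q : Matrix (Fin N) (Fin N) ℂ =>
          -((N : ℝ) ^ 2 / (4 * ((N : ℝ) ^ 2 - 4))) * (Q * Δ * Q * B).trace.re
            + ((N : ℝ) / (2 * ((N : ℝ) ^ 2 - 4))) * ((Q * B).trace * (Q * Δ).trace).re
            - (1 / (4 * (N : ℝ))) * ((Q * B).trace * (starRingEnd ℂ) (Q * Δ).trace).re) g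
        ∂(haarProbability (SUN N)).tilted (fun g => (N : ℝ) * ((g : Matrix (Fin N) (Fin N) ℂ) * B).trace.re)) ≤
      (4 * ((N : ℝ) ^ 2 / (4 * ((N : ℝ) ^ 2 - 4))) * matrixOpNorm B ^ 2 * frobNorm Δ + frobNorm B ^ 2 * frobNorm Δ * (1 / 2 * (((N : ℝ) / (2 * ((N : ℝ) ^ 2 - 4))) + 1 / (4 * (N : ℝ))) + 1 / 2 * (((N : ℝ) / (2 * ((N : ℝ) ^ 2 - 4))) - 1 / (4 * (N : ℝ)))))
        + (frobNorm Δ * matrixOpNorm B * (4 * ((N : ℝ) ^ 2 / (4 * ((N : ℝ) ^ 2 - 4))) / N + (((N : ℝ) / (2 * ((N : ℝ) ^ 2 - 4))) + 1 / (4 * (N : ℝ))) + 2 * ((N : ℝ) / (2 * ((N : ℝ) ^ 2 - 4))))) *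
          Real.sqrt (∫ g, ‖((g : Matrix (Fin N) (Fin N) ℂ) * B).trace‖ ^ 2
            ∂(haarProbability (SUN N)).tilted (fun g => (N : ℝ) * ((g : Matrix (Fin N) (Fin N) ℂ) * B).trace.re))
        + (frobNorm B * ((((N : ℝ) / (2 * ((N : ℝ) ^ 2 - 4))) + 1 / (4 * (N : ℝ))) * matrixOpNorm B + 2 * ((N : ℝ) / (2 * ((N : ℝ) ^ 2 - 4))) * matrixOpNorm B + 2 * ((N : ℝ) / (2 * ((N : ℝ) ^ 2 - 4))) / N * Real.sqrt N * frobNorm B)) *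
          Real.sqrt (∫ g, ‖((g : Matrix (Fin N) (Fin N) ℂ) * Δ).trace‖ ^ 2
            ∂(haarProbability (SUN N)).tilted (fun g => (N : ℝ) * ((g : Matrix (Fin N) (Fin N) ℂ) * B).trace.re))
        + (frobNorm B * (2 * ((N : ℝ) ^ 2 / (4 * ((N : ℝ) ^ 2 - 4))) / N + 1 / 2 * (((N : ℝ) / (2 * ((N : ℝ) ^ 2 - 4))) + 1 / (4 * (N : ℝ))))) *
          Real.sqrt (∫ g, ‖((g : Matrix (Fin N) (Fin N) ℂ) * Δ * g * B).trace‖ ^ 2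
            ∂(haarProbability (SUN N)).tilted (fun g => (N : ℝ) * ((g : Matrix (Fin N) (Fin N) ℂ) * B).trace.re))
        + (frobNorm Δ * (1 / 2 * (((N : ℝ) / (2 * ((N : ℝ) ^ 2 - 4))) + 1 / (4 * (N : ℝ))))) *
          Real.sqrt (∫ g, ‖((g : Matrix (Fin N) (Fin N) ℂ) * B * g * B).trace‖ ^ 2
            ∂(haarProbability (SUN N)).tilted (fun g => (N : ℝ) * ((g : Matrix (Fin N) (Fin N) ℂ) * B).trace.re)) := by
  have hN0 : N ≠ 0 := by omega
  have h3 : (3 : ℝ) ≤ N := by exact_mod_cast hN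
  have hN4 : (0 : ℝ) < (N : ℝ) ^ 2 - 4 := by nlinarith
  have hNpos : (0 : ℝ) < N := by linarith
  set κw : ℝ := (N : ℝ) ^ 2 / (4 * ((N : ℝ) ^ 2 - 4)) with hκw
  set κt : ℝ := (N : ℝ) / (2 * ((N : ℝ) ^ 2 - 4)) with hκt
  set c : ℝ := 1 / (4 * (N : ℝ)) with hc
  have hκw0 : 0 ≤ κw := by positivity
  have hκt0 : 0 ≤ κt := by positivity
  have hc0 : 0 ≤ c := by positivity
  have hcκ : c ≤ κt := by
    rw [hc, hκt, div_le_div_iff₀ (by positivity) (by positivity)]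
    nlinarith
  set ν : Measure (SUN N) := (haarProbability (SUN N)).tilted (fun g => (N : ℝ) * ((g : Matrix (Fin N) (Fin N) ℂ) * B).trace.re) with hν
  have hexpi : Integrable (fun g : SUN N => Real.exp ((N : ℝ) * ((g : Matrix (Fin N) (Fin N) ℂ) * B).trace.re))
      (haarProbability (SUN N)) :=
    integrable_of_continuous_SUN (Real.continuous_exp.comp (continuous_restrict (contDiff_pot (N : ℝ) B))) _
  haveI : IsProbabilityMeasure ν := isProbabilityMeasure_tilted hexpi
  have hc3 := contDiff_Gam (contDiff_pot (N := N) 1 B) (contDiff_psiTwo N B Δ)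
  have hB0 := matrixOpNorm_nonneg B
  have hBF := frobNorm_nonneg B
  have hΔ := frobNorm_nonneg Δ
  set κm : ℝ := κt - c with hκm
  have hκc : 0 ≤ κm := by rw [hκm]; linarith
  set a : ℝ := 4 * κw * matrixOpNorm B ^ 2 * frobNorm Δ + frobNorm B ^ 2 * frobNorm Δ * (1 / 2 * (κt + c) + 1 / 2 * κm) with ha
  set b₁ : ℝ := frobNorm Δ * matrixOpNorm B * (4 * κw / N + (κt + c) + 2 * κt) with hb₁
  set b₂ : ℝ := frobNorm B * ((κt + c) * matrixOpNorm B + 2 * κt * matrixOpNorm B + 2 * κt / N * Real.sqrt N * frobNorm B)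
    with hb₂
  set b₃ : ℝ := frobNorm B * (2 * κw / N + 1 / 2 * (κt + c)) with hb₃
  set b₄ : ℝ := frobNorm Δ * (1 / 2 * (κt + c)) with hb₄
  have ha0 : 0 ≤ a := by positivity
  have hb₁0 : 0 ≤ b₁ := by positivity
  have hb₂0 : 0 ≤ b₂ := by positivity
  have hb₃0 : 0 ≤ b₃ := by positivity
  have hb₄0 : 0 ≤ b₄ := by positivity
  set fb : SUN N → ℝ := fun g => b₁ * ‖((g : Matrix (Fin N) (Fin N) ℂ) * B).trace‖ with hfb
  set fc : SUN N → ℝ := fun g => b₂ * ‖((g : Matrix (Fin N) (Fin N) ℂ) * Δ).trace‖ with hfc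
  set fd : SUN N → ℝ := fun g => b₃ * ‖((g : Matrix (Fin N) (Fin N) ℂ) * Δ * (g : Matrix (Fin N) (Fin N) ℂ) * B).trace‖ with hfd
  set fe : SUN N → ℝ := fun g => b₄ * ‖((g : Matrix (Fin N) (Fin N) ℂ) * B * (g : Matrix (Fin N) (Fin N) ℂ) * B).trace‖ with hfe
  have cG : Continuous fun g : SUN N => (g : Matrix (Fin N) (Fin N) ℂ) := continuous_subtype_val
  have htr : ∀ M : Matrix (Fin N) (Fin N) ℂ, Continuous fun g : SUN N => ((g : Matrix (Fin N) (Fin N) ℂ) * M).trace :=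
    fun M => (cG.matrix_mul continuous_const).matrix_trace
  have hquad : ∀ M₁ M₂ : Matrix (Fin N) (Fin N) ℂ,
      Continuous fun g : SUN N => ((g : Matrix (Fin N) (Fin N) ℂ) * M₁ * (g : Matrix (Fin N) (Fin N) ℂ) * M₂).trace :=
    fun M₁ M₂ => (((cG.matrix_mul continuous_const).matrix_mul cG).matrix_mul continuous_const).matrix_trace
  have hfbc : Continuous fb := continuous_const.mul (continuous_norm.comp (htr B))
  have hfcc : Continuous fc := continuous_const.mul (continuous_norm.comp (htr Δ))
  have hfdc : Continuous fd := continuous_const.mul (continuous_norm.comp (hquad Δ B))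
  have hfec : Continuous fe := continuous_const.mul (continuous_norm.comp (hquad B B))
  have key := sqrt_integral_le_of_le_add_sq_four (a := a) (continuous_restrict (contDiff_Gam hc3 hc3)) hfbc hfcc hfdc hfec ha0
    (fun g => ?_) ν
  · have esq : ∀ (β : ℝ) (f : SUN N → ℝ), 0 ≤ β →
        Real.sqrt (∫ x, (β * f x) ^ 2 ∂ν) = β * Real.sqrt (∫ x, f x ^ 2 ∂ν) := by
      intro β f hβ
      have : (fun x => (β * f x) ^ 2) = fun x => β ^ 2 * f x ^ 2 := by funext x; ring
      rw [this, integral_const_mul, Real.sqrt_mul (sq_nonneg _), Real.sqrt_sq hβ]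
    have eb := esq b₁ (fun g => ‖((g : Matrix (Fin N) (Fin N) ℂ) * B).trace‖) hb₁0
    have ec := esq b₂ (fun g => ‖((g : Matrix (Fin N) (Fin N) ℂ) * Δ).trace‖) hb₂0
    have ed := esq b₃ (fun g => ‖((g : Matrix (Fin N) (Fin N) ℂ) * Δ * (g : Matrix (Fin N) (Fin N) ℂ) * B).trace‖) hb₃0
    have ee := esq b₄ (fun g => ‖((g : Matrix (Fin N) (Fin N) ℂ) * B * (g : Matrix (Fin N) (Fin N) ℂ) * B).trace‖) hb₄0
    simp only [hfb, hfc, hfd, hfe] at key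
    rw [eb, ec, ed, ee] at key
    exact key
  · have hP := Gam_c3_le hN B Δ g
    have haff := c3bound_le_affineQ hN B Δ g
    rw [← hκw, ← hκt, ← hc] at haff hP
    have hP0 : 0 ≤ 4 * κw * matrixOpNorm B ^ 2 * frobNorm Δ
        + 2 * κw / N *
          (2 * matrixOpNorm B * frobNorm Δ * |((g : Matrix (Fin N) (Fin N) ℂ) * B).trace.im|
            + frobNorm B * ‖((g : Matrix (Fin N) (Fin N) ℂ) * Δ * g * B).trace‖)
        + 1 / 2 * (κt + c) *
          (2 * matrixOpNorm B * frobNorm B * ‖((g : Matrix (Fin N) (Fin N) ℂ) * Δ).trace‖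
            + frobNorm Δ * ‖((g : Matrix (Fin N) (Fin N) ℂ) * B * g * B).trace‖)
        + 1 / 2 * (κt + c) *
          (2 * matrixOpNorm B * frobNorm Δ * ‖((g : Matrix (Fin N) (Fin N) ℂ) * B).trace‖
            + frobNorm B * ‖((g : Matrix (Fin N) (Fin N) ℂ) * Δ * g * B).trace‖)
        + 1 / 2 * κm * frobNorm B ^ 2 * frobNorm Δ
        + 1 / 2 * (κt + c) * frobNorm B ^ 2 * frobNorm Δ
        + 2 * κt / N *
          (frobNorm B * |((g : Matrix (Fin N) (Fin N) ℂ) * B).trace.im| * ‖((g : Matrix (Fin N) (Fin N) ℂ) * Δ).trace‖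
            + frobNorm Δ * |((g : Matrix (Fin N) (Fin N) ℂ) * B).trace.im| * ‖((g : Matrix (Fin N) (Fin N) ℂ) * B).trace‖
            + frobNorm B * ‖((g : Matrix (Fin N) (Fin N) ℂ) * B).trace‖ * ‖((g : Matrix (Fin N) (Fin N) ℂ) * Δ).trace‖) := by
      positivity
    simp only [hfb, hfc, hfd, hfe]
    calc _ ≤ _ := hP
      _ ≤ (a + b₁ * ‖((g : Matrix (Fin N) (Fin N) ℂ) * B).trace‖ + b₂ * ‖((g : Matrix (Fin N) (Fin N) ℂ) * Δ).trace‖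
            + b₃ * ‖((g : Matrix (Fin N) (Fin N) ℂ) * Δ * (g : Matrix (Fin N) (Fin N) ℂ) * B).trace‖
            + b₄ * ‖((g : Matrix (Fin N) (Fin N) ℂ) * B * (g : Matrix (Fin N) (Fin N) ℂ) * B).trace‖) ^ 2 := by
          refine pow_le_pow_left₀ hP0 ?_ 2
          calc _ ≤ _ := haff
            _ = _ := by simp only [ha, hb₁, hb₂, hb₃, hb₄, hκm]

/-! ### Real-arithmetic bookkeeping for the assembly (consumed by `OneLinkLevelTwoQuad`) -/

/-- Coefficient identity for the cubic-remainder gradient norm with the quadratic scale `T`. [folklore] -/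
theorem levelTwo_idCWQ (hN : (N : ℝ) ≠ 0) (E W T r : ℝ) :
    4 * (E / 2) * r ^ 2 + N * r ^ 2 * (1 / 2 * (E / N + 1 / (4 * (N : ℝ))) + 1 / 2 * (E / N - 1 / (4 * (N : ℝ))))
      + r * (4 * (E / 2) / N + (E / N + 1 / (4 * (N : ℝ))) + 2 * (E / N)) * W
      + r * ((E / N + 1 / (4 * (N : ℝ))) + 4 * (E / N)) * W
      + (2 * (E / 2) / N + 1 / 2 * (E / N + 1 / (4 * (N : ℝ)))) * ((N : ℝ) * T)
      + 1 / 2 * (E / N + 1 / (4 * (N : ℝ))) * ((N : ℝ) * T) =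
      3 * E * r ^ 2 + (2 * E + 1 / 4) * T + ((10 * E + 1 / 2) / N) * r * W := by
  field_simp
  ring

/-- Bookkeeping for the cubic-remainder gradient norm with the quadratic words in `L²`. [folklore] -/
theorem levelTwo_m2Q {KW KT CC Nr S r nB nD Z₁ Z₂ WDB WBB Gc W T : ℝ} (hNr : Nr ≠ 0) (hKW : 0 ≤ KW) (hKT : 0 ≤ KT) (hCC : 0 ≤ CC)
    (hr : 0 ≤ r) (hnB : 0 ≤ nB) (hnD : 0 ≤ nD) (hW : 0 ≤ W) (hS : 0 ≤ S) (hNr0 : 0 ≤ Nr)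
    (F1 : Z₁ ≤ W) (F2 : nB * Z₂ ≤ nD * W) (F4 : S * nB ≤ Nr * r) (Q1 : WBB ≤ Nr * T) (Q2 : nB * WDB ≤ nD * (Nr * T))
    (hc : Gc ≤ (4 * KW * r ^ 2 * nD + nB ^ 2 * nD * (1 / 2 * (KT + CC) + 1 / 2 * (KT - CC)))
        + nD * r * (4 * KW / Nr + (KT + CC) + 2 * KT) * Z₁
        + nB * ((KT + CC) * r + 2 * KT * r + 2 * KT / Nr * S * nB) * Z₂
        + nB * (2 * KW / Nr + 1 / 2 * (KT + CC)) * WDB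
        + nD * (1 / 2 * (KT + CC)) * WBB)
    (F3 : nB ^ 2 ≤ Nr * r ^ 2) (hKm : 0 ≤ KT - CC) :
    Gc ≤ nD * (4 * KW * r ^ 2 + Nr * r ^ 2 * (1 / 2 * (KT + CC) + 1 / 2 * (KT - CC))
      + r * (4 * KW / Nr + (KT + CC) + 2 * KT) * W + r * ((KT + CC) + 4 * KT) * W
      + (2 * KW / Nr + 1 / 2 * (KT + CC)) * (Nr * T) + 1 / 2 * (KT + CC) * (Nr * T)) := by
  have hσ : 0 ≤ 1 / 2 * (KT + CC) + 1 / 2 * (KT - CC) := by positivity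
  have u1 : nB ^ 2 * nD * (1 / 2 * (KT + CC) + 1 / 2 * (KT - CC)) ≤ Nr * r ^ 2 * nD * (1 / 2 * (KT + CC) + 1 / 2 * (KT - CC)) :=
    mul_le_mul_of_nonneg_right (mul_le_mul_of_nonneg_right F3 hnD) hσ
  have u2 : nD * r * (4 * KW / Nr + (KT + CC) + 2 * KT) * Z₁ ≤ nD * r * (4 * KW / Nr + (KT + CC) + 2 * KT) * W :=
    mul_le_mul_of_nonneg_left F1 (by positivity)
  have hβ0 : 0 ≤ (KT + CC) * r + 2 * KT * r + 2 * KT / Nr * S * nB := by positivity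
  have u3a : nB * ((KT + CC) * r + 2 * KT * r + 2 * KT / Nr * S * nB) * Z₂ ≤
      ((KT + CC) * r + 2 * KT * r + 2 * KT / Nr * S * nB) * (nD * W) := by
    have e : nB * ((KT + CC) * r + 2 * KT * r + 2 * KT / Nr * S * nB) * Z₂ =
        ((KT + CC) * r + 2 * KT * r + 2 * KT / Nr * S * nB) * (nB * Z₂) := by ring
    rw [e]; exact mul_le_mul_of_nonneg_left F2 hβ0
  have u3b : (KT + CC) * r + 2 * KT * r + 2 * KT / Nr * S * nB ≤ (KT + CC) * r + 2 * KT * r + 2 * KT * r := by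
    have h1 : 2 * KT / Nr * (S * nB) ≤ 2 * KT / Nr * (Nr * r) := mul_le_mul_of_nonneg_left F4 (by positivity)
    have e1 : 2 * KT / Nr * (Nr * r) = 2 * KT * r := by rw [div_mul_eq_mul_div, div_eq_iff hNr]; ring
    have e2 : 2 * KT / Nr * S * nB = 2 * KT / Nr * (S * nB) := by ring
    rw [e2]; linarith only [h1, e1]
  have u3 : nB * ((KT + CC) * r + 2 * KT * r + 2 * KT / Nr * S * nB) * Z₂ ≤
      ((KT + CC) * r + 2 * KT * r + 2 * KT * r) * (nD * W) :=
    u3a.trans (mul_le_mul_of_nonneg_right u3b (mul_nonneg hnD hW))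
  have u4 : nB * (2 * KW / Nr + 1 / 2 * (KT + CC)) * WDB ≤ (2 * KW / Nr + 1 / 2 * (KT + CC)) * (nD * (Nr * T)) := by
    have e : nB * (2 * KW / Nr + 1 / 2 * (KT + CC)) * WDB = (2 * KW / Nr + 1 / 2 * (KT + CC)) * (nB * WDB) := by ring
    rw [e]; exact mul_le_mul_of_nonneg_left Q2 (by positivity)
  have u5 : nD * (1 / 2 * (KT + CC)) * WBB ≤ nD * (1 / 2 * (KT + CC)) * (Nr * T) := mul_le_mul_of_nonneg_left Q1 (by positivity)
  simp only [div_eq_mul_inv] at hc u1 u2 u3 u4 u5 ⊢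
  linarith only [hc, u1, u2, u3, u4, u5]

end Summit.Ventures.YMGap.OneLinkEigen
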